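import Summits.AtomisticToContinuum.FouriersLaw.Theses.BondHeatUncertainty
import Literature.MathematicalPhysics.KineticTheory.LangevinChainReversal
import Literature.Probability.Entropy.FluctuationTheoremUncertainty
import Summits.AtomisticToContinuum.FouriersLaw.Theorems.BondHeatUncertaintyDefs
import Summits.AtomisticToContinuum.FouriersLaw.Theorems.BondHeatUncertaintyLinearResponseFTURBondHeatVarianceContinuityHelper5
import Summits.AtomisticToContinuum.FouriersLaw.Theorems.BondHeatUncertaintyLinearResponseFTURBondHeatVarianceContinuityHelper8
import Summits.AtomisticToContinuum.FouriersLaw.Theorems.BondHeatUncertaintyLinearResponseFTURBondHeatVarianceContinuityHelper9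

/-!
# Stub `stub_bondHeatVarianceContinuity` of line `lebesgue-flip-duality` (crux ★ `LinearResponseFTUR`,
# stmt-AtomisticToContinuum-9122) — K6b: δ-continuity of the bond-heat variance

Target: `Summits/AtomisticToContinuum/FouriersLaw/Theorems/BondHeatUncertaintyLinearResponseFTURBondHeatVarianceContinuity.lean`.
Under weak-NESS uniqueness and along a steady-state family `μ`, for `T > 0`, `N ≥ 2`, a real bond `ib` and
`t > 0`, the bond heat `Q_t = ∫₀ᵗ j_b(z_s) ds` is square integrable under the flux law of the stationary process
at temperatures `T ± δ/2` for all small `δ`, and `Var_δ(Q_t) → Var_0(Q_t)` as `δ → 0`, `δ ≠ 0`, the limit being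
the variance under the equal-temperature member `μ N T T`.

Proof (Helpers 1–9 of this stub):
* the variance is the kernel-level quantity `2∫₀ᵗ (t-r) ∫ j·(P^δ_r j) dμ_δ dr - (t μ_δ(j))²` (Helper 9, from
  the tree's second-moment formula along the stationary flow and the one-time law);
* the family `μ_δ` has exponential moments `∫ e^{H/(2T)} dμ_δ ≤ M` UNIFORMLY in `|δ| ≤ T` (Helpers 1–3: CEHR
  Theorem 5.1 / H2 re-run with constants uniform on the temperature box, plus kernel invariance), is tight, and
  converges weakly to `μ_T` (Helper 4: Prokhorov, closedness of the weak Fokker–Planck class, uniqueness), also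
  on exponentially dominated observables such as `j` (Helper 5);
* for every lag `r`, `∫ j·(P^δ_r j) dμ_δ → ∫ j·(P^0_r j) dμ_T` (Helper 8: energy truncation of the current,
  Helper 7; continuity of the kernels in the noise amplitude uniformly on energy shells, Helper 6; Feller +
  weak convergence), with the uniform bound `|∫ j·(P^δ_r j) dμ_δ| ≤ 2∫ j² dμ_δ ≤ 2C²M`, so dominated convergence
  in `r` and the convergence of the means conclude.
-/

noncomputable section


namespace Summit.AtomisticToContinuum.FouriersLaw.Theorems.LinearResponseFTUR

open MeasureTheory ProbabilityTheory Filter Topology Set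
open scoped NNReal ENNReal Topology
open Literature.MathematicalPhysics.KineticTheory
open Literature.MathematicalPhysics.KineticTheory.HeatConduction
open Literature.Probability.Process
open Summit.AtomisticToContinuum.FouriersLaw.Theorems.BondHeatUncertainty
open Summit.AtomisticToContinuum.FouriersLaw.Theorems.SubdiffusiveBondHeat

/-- **K6b — δ-continuity of the bond-heat variance along the NESS family** (registered stub of line
`lebesgue-flip-duality`, crux ★ `LinearResponseFTUR`): for the pinned chain (all parameters `> 0`), under
weak-NESS uniqueness and along a steady-state family `μ`, for `T > 0`, `N ≥ 2`, a real bond `ib` and `t > 0`,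
the bond-heat coordinate is square integrable under `fluxLaw … (T+δ/2) (T-δ/2) t (μ N (T+δ/2) (T-δ/2))` for all
small `δ ≠ 0`, and its variance tends, as `δ → 0`, `δ ≠ 0`, to the variance under the equal-temperature member
`μ N T T`. Proof: kernel-level variance formula (Helper 9), uniform exponential moments and weak convergence of
the NESS family (Helpers 1–5), δ-continuity of the current–current correlation at every lag (Helpers 6–8),
dominated convergence in the lag. -/
theorem stub_bondHeatVarianceContinuity :
  ∀ ω₂ lam β γ : ℝ, 0 < ω₂ → 0 < lam → 0 < β → 0 < γ →
  (∀ (N : ℕ) (T_L T_R : ℝ), 0 < T_L → 0 < T_R → ∀ μ ν : Measure (PhaseSpace N),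
    (pinnedChain ω₂ lam β γ).IsSteadyState N T_L T_R μ →
    (pinnedChain ω₂ lam β γ).IsSteadyState N T_L T_R ν → μ = ν) →
  ∀ μ : (N : ℕ) → ℝ → ℝ → Measure (PhaseSpace N),
    (∀ (N : ℕ) (T_L T_R : ℝ), 0 < T_L → 0 < T_R →
      (pinnedChain ω₂ lam β γ).IsSteadyState N T_L T_R (μ N T_L T_R)) →
  ∀ T : ℝ, 0 < T → ∀ (N : ℕ) (i0 iN ib : Fin N), 2 ≤ N → i0.val = 0 → iN.val = N - 1 →
    ib.val + 1 < N → ∀ t : ℝ, 0 < t →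
    (∀ᶠ δ in 𝓝[≠] (0 : ℝ), MemLp (fun p : Obs N => p.2.2.2.2) 2
      (fluxLaw (pinnedChain ω₂ lam β γ) N i0 iN ib (T + δ / 2) (T - δ / 2) t
        (μ N (T + δ / 2) (T - δ / 2)))) ∧
    Tendsto (fun δ : ℝ => variance (fun p : Obs N => p.2.2.2.2)
        (fluxLaw (pinnedChain ω₂ lam β γ) N i0 iN ib (T + δ / 2) (T - δ / 2) t
          (μ N (T + δ / 2) (T - δ / 2)))) (𝓝[≠] 0)
      (𝓝 (variance (fun p : Obs N => p.2.2.2.2)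
        (fluxLaw (pinnedChain ω₂ lam β γ) N i0 iN ib T T t (μ N T T)))) := by
  intro ω₂ lam β γ hω hl hβ hγ huniq μ hμ T hT N i0 iN ib hN hi0 hiN hib t ht
  set P := pinnedChain ω₂ lam β γ with hP
  set H := P.hamiltonian N with hH
  have hH0 : ∀ x, 0 ≤ H x := fun x => pinnedChain_hamiltonian_nonneg hω.le hl.le hβ.le γ N x
  set j := P.bondCurrent N ib with hj
  have hjc : Continuous j := pinnedChain_continuous_bondCurrent ω₂ lam β γ N ib
  have hjm : Measurable j := hjc.measurable
  set ϑ : ℝ := 1 / (2 * T) with hϑ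
  have hϑ0 : 0 < ϑ := by positivity
  have hϑ4 : ϑ / 4 < 1 / (2 * T) := by rw [hϑ]; exact div_lt_self (by positivity) (by norm_num)
  obtain ⟨M, hM⟩ := ness_uniform_exp_moment ω₂ lam β γ hω hl hβ hγ huniq μ hμ T hT N hN
  -- the box `|δ| ≤ T`
  have hpos : ∀ δ : ℝ, |δ| ≤ T → 0 < T + δ / 2 ∧ 0 < T - δ / 2 := fun δ hδ => by
    have h := abs_le.1 hδ
    exact ⟨by linarith only [hT, h.1], by linarith only [hT, h.2]⟩
  have hprob : ∀ δ : ℝ, |δ| ≤ T → IsProbabilityMeasure (μ N (T + δ / 2) (T - δ / 2)) := fun δ hδ =>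
    (hμ N _ _ (hpos δ hδ).1 (hpos δ hδ).2).1
  have hinv : ∀ δ : ℝ, |δ| ≤ T → ∀ s : ℝ≥0,
      (μ N (T + δ / 2) (T - δ / 2)).bind (P.transitionKernel N (T + δ / 2) (T - δ / 2) s) =
        μ N (T + δ / 2) (T - δ / 2) := fun δ hδ =>
    (ness_facts ω₂ lam β γ hω hl hβ hγ huniq μ hμ N hN _ _ (hpos δ hδ).1 (hpos δ hδ).2).2.1
  have hzero : |(0 : ℝ)| ≤ T := by simpa using hT.le
  have hbox : ∀ᶠ δ : ℝ in 𝓝[≠] 0, |δ| ≤ T := by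
    have h1 : Metric.closedBall (0 : ℝ) T ∈ 𝓝[≠] (0 : ℝ) :=
      mem_nhdsWithin_of_mem_nhds (Metric.closedBall_mem_nhds 0 hT)
    filter_upwards [h1] with δ hδ1
    simpa [Real.dist_eq] using hδ1
  -- the current: exponential domination and square integrability on the box
  obtain ⟨Cj, hCj0, hCj⟩ := k6b_abs_bondCurrent_le_exp hω.le hl.le hβ.le γ N ib (ε := ϑ / 4) (by positivity)
  have hj2V : ∀ x, j x ^ 2 ≤ Cj ^ 2 * Real.exp (ϑ * H x) := fun x => by
    have h1 : j x ^ 2 ≤ (Cj * Real.exp (ϑ / 4 * H x)) ^ 2 := by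
      rw [← sq_abs]; exact pow_le_pow_left₀ (abs_nonneg _) (hCj x) 2
    refine h1.trans ?_
    rw [mul_pow, ← Real.exp_nat_mul]
    refine mul_le_mul_of_nonneg_left (Real.exp_le_exp.2 ?_) (sq_nonneg _)
    push_cast
    nlinarith only [hH0 x, hϑ0]
  have hj2 : ∀ δ : ℝ, |δ| ≤ T → Integrable (fun y => j y ^ 2) (μ N (T + δ / 2) (T - δ / 2)) ∧
      ∫ y, j y ^ 2 ∂(μ N (T + δ / 2) (T - δ / 2)) ≤ Cj ^ 2 * M := by
    intro δ hδ
    obtain ⟨hint, hle⟩ := hM δ hδ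
    have hi : Integrable (fun y => j y ^ 2) (μ N (T + δ / 2) (T - δ / 2)) :=
      (hint.const_mul (Cj ^ 2)).mono' (hjc.pow 2).aestronglyMeasurable (Eventually.of_forall fun x => by
        rw [Real.norm_eq_abs, abs_of_nonneg (sq_nonneg _)]; exact hj2V x)
    refine ⟨hi, ?_⟩
    calc ∫ y, j y ^ 2 ∂(μ N (T + δ / 2) (T - δ / 2))
        ≤ ∫ y, Cj ^ 2 * Real.exp (ϑ * H y) ∂(μ N (T + δ / 2) (T - δ / 2)) := integral_mono hi (hint.const_mul _) hj2V
      _ = Cj ^ 2 * ∫ y, Real.exp (ϑ * H y) ∂(μ N (T + δ / 2) (T - δ / 2)) := integral_const_mul _ _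
      _ ≤ Cj ^ 2 * M := mul_le_mul_of_nonneg_left hle (sq_nonneg _)
  -- the kernel-level variance formula on the box
  have hV : ∀ δ : ℝ, |δ| ≤ T →
      MemLp (fun p : Obs N => p.2.2.2.2) 2
        (fluxLaw P N i0 iN ib (T + δ / 2) (T - δ / 2) t (μ N (T + δ / 2) (T - δ / 2))) ∧
      variance (fun p : Obs N => p.2.2.2.2)
        (fluxLaw P N i0 iN ib (T + δ / 2) (T - δ / 2) t (μ N (T + δ / 2) (T - δ / 2))) =
        2 * (∫ r in (0:ℝ)..t, (t - r) * ∫ y, j y * (∫ y', j y'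
            ∂(P.transitionKernel N (T + δ / 2) (T - δ / 2) r.toNNReal y)) ∂(μ N (T + δ / 2) (T - δ / 2))) -
          (t * ∫ y, j y ∂(μ N (T + δ / 2) (T - δ / 2))) ^ 2 := by
    intro δ hδ
    haveI := hprob δ hδ
    exact varianceBondHeatFluxLaw ω₂ lam β γ hω hl.le hβ.le hγ.le N _ _ i0 iN ib (μ N (T + δ / 2) (T - δ / 2))
      inferInstance (hinv δ hδ) (hj2 δ hδ).1 t ht.le
  refine ⟨?_, ?_⟩
  · filter_upwards [hbox] with δ hδ
    exact (hV δ hδ).1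
  -- (i) the mean
  have hmean := (ness_tendsto_integral_of_growth ω₂ lam β γ hω hl hβ hγ huniq μ hμ T hT N hN j hjc Cj (ϑ / 4)
    (by positivity) hϑ4 hCj).2
  -- (ii) the lag integral, by dominated convergence
  have hI : Tendsto (fun δ : ℝ => ∫ r in (0:ℝ)..t, (t - r) * ∫ y, j y * (∫ y', j y'
        ∂(P.transitionKernel N (T + δ / 2) (T - δ / 2) r.toNNReal y)) ∂(μ N (T + δ / 2) (T - δ / 2)))
      (𝓝[≠] 0) (𝓝 (∫ r in (0:ℝ)..t, (t - r) * ∫ y, j y * (∫ y', j y'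
        ∂(P.transitionKernel N T T r.toNNReal y)) ∂(μ N T T))) := by
    refine intervalIntegral.tendsto_integral_filter_of_dominated_convergence
      (bound := fun _ => t * (Cj ^ 2 * M + Cj ^ 2 * M)) ?_ ?_ ?_ ?_
    · filter_upwards [hbox] with δ hδ
      haveI := hprob δ hδ
      exact ((continuous_const.sub continuous_id).measurable.mul
        (pinnedChain_measurable_kernelPairing hω hl.le hβ.le hγ.le N _ _ (μ N (T + δ / 2) (T - δ / 2))
          hjm hjm)).aestronglyMeasurable
    · filter_upwards [hbox] with δ hδ
      haveI := hprob δ hδ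
      refine Eventually.of_forall fun r hr => ?_
      rw [Set.uIoc_of_le ht.le] at hr
      have hpair := pinnedChain_abs_kernelPairing_le hω hl.le hβ.le hγ.le N _ _ (μ N (T + δ / 2) (T - δ / 2))
        (hinv δ hδ) hjm hjm (hj2 δ hδ).1 (hj2 δ hδ).1 r
      rw [norm_mul, Real.norm_eq_abs, Real.norm_eq_abs]
      refine mul_le_mul ?_ (hpair.trans (add_le_add (hj2 δ hδ).2 (hj2 δ hδ).2)) (abs_nonneg _) ht.le
      rw [abs_of_nonneg (by linarith only [hr.2])]
      linarith only [hr.1]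
    · exact intervalIntegrable_const
    · refine Eventually.of_forall fun r hr => ?_
      rw [Set.uIoc_of_le ht.le] at hr
      exact (ness_tendsto_currentPairing ω₂ lam β γ hω hl hβ hγ huniq μ hμ T hT N ib hN r hr.1.le).const_mul _
  -- (iii) conclusion
  have hlim := (hI.const_mul 2).sub ((hmean.const_mul t).pow 2)
  have hV0 := hV 0 hzero
  simp only [zero_div, add_zero, sub_zero] at hV0
  rw [hV0.2]
  refine hlim.congr' ?_
  filter_upwards [hbox] with δ hδ
  exact (hV δ hδ).2.symm

end Summit.AtomisticToContinuum.FouriersLaw.Theorems.LinearResponseFTUR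

end
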